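/-
Copyright (c) 2026. All rights reserved.
Released under Apache 2.0 license as described in the file LICENSE.
Authors: abc-iut cell, block C / W6 prover seat abc-iut-w6-d060 (gen 2).
-/
import Literature.IUT.LogVolume.UnitLogDeepRamification
import Literature.IUT.LogVolume.UnitLogBoundaryRamificationTrichotomy
import Literature.IUT.LogVolume.LogRadius
import HarnessLib

/-!
# `log_p(𝒪_K^×)` for `K` WITHOUT non-trivial `p`-th roots of unity (`p` odd): it is a ball iff `e ≤ p − 1`,
# and then it is `𝔪_K`

PROOF-ONLY file (no `def`, no named fact): the torsion-free summary of the classical computation of the image of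
the `p`-adic logarithm on units, assembled BY NAME from [IUTchIV] Prop. 1.2 (i) (`prop12iEq_holds`, tame
`e ≤ p − 2`), the boundary trichotomy (W1) (`logUnits_eq_closedBall_of_forall_pow_prime_eq_one`, `e = p − 1`) and
the deep case (`DeepRamification.closedBall_ne_zpow_smul_logUnits_of_prime_le`, `e ≥ p`).  Setting: `K` a proper
ultrametric normed `ℚ_p`-algebra, `p` ODD, `ϖ` a uniformizer, `e = absRamificationIdx p K`, and `K` has no
`ζ ≠ 1` with `ζ^p = 1`.

* `logUnits_eq_closedBall_of_le_pred` — `e ≤ p − 1` ⇒ `log_p(𝒪_K^×) = 𝔪_K = {‖z‖ ≤ ‖ϖ‖}`;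
* `exists_logUnits_eq_closedBall_zpow_iff` — `log_p(𝒪_K^×) = {‖z‖ ≤ ‖ϖ‖^j}` for some `j ∈ ℤ` **iff** `e ≤ p − 1`;
* `exists_closedBall_eq_zpow_smul_logUnits_iff` — some ball `{‖z‖ ≤ ‖ϖ‖^j}` is some `p^k·log_p(𝒪_K^×)` iff `e ≤ p − 1`
  (the shape consumed by the Dupuy–Hilado (Ind2) ball-mover criterion).

References: [cite: NeukirchANT1999, Ch. II Prop. (5.5)–(5.7)] [cite: Koblitz1984, Ch. IV §1–2]; `logUnits` is the
cell's typing of [IUTchIV] Prop. 1.2's `log_p(R^×)` ([claim: Mochizuki2012, status: disputed] for that locution).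
-/

noncomputable section

open Metric Set IsUltrametricDist
open scoped Pointwise

namespace Literature.IUT.LogVolume

open Literature.NumberTheory.GaloisRepresentations.Ultrametric

namespace TorsionFree

variable (p : ℕ) [hp : Fact p.Prime]
variable {K : Type*} [NontriviallyNormedField K] [instK : NormedAlgebra ℚ_[p] K] [IsUltrametricDist K]
  [ProperSpace K]
variable {ϖ : Kˣ} (hϖ : IsUniformizer ϖ) (hμ : ∀ ζ : K, ζ ^ p = 1 → ζ = 1)
include hϖ hμ

omit hμ in
/-- **Tame evaluation** ([IUTchIV] Prop. 1.2 (i), equality clause): `p > 2`, `e ≤ p − 2` ⇒ `log_p(𝒪_K^×) = 𝔪_K`.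
[cite: NeukirchANT1999, Ch. II Prop. (5.5)] [claim: Mochizuki2012, status: disputed] -/
theorem logUnits_eq_closedBall_of_le_sub_two (hp2 : 2 < p) (he : absRamificationIdx p K ≤ p - 2) :
    logUnits K = closedBall (0 : K) ‖(ϖ : K)‖ := by
  have he1 : 1 ≤ absRamificationIdx p K := absRamificationIdx_pos p K
  have h := (prop12iEq_holds p K hp2 he).1
  rw [← h, pBall_eq_closedBall, norm_eq_rpow_of_isUniformizer p K hϖ, logRadiusA_eq hp2 he1 he]

/-- **No `ζ_p ≠ 1` and `e ≤ p − 1` ⇒ `log_p(𝒪_K^×) = 𝔪_K`** (`p` odd): tame range by [IUTchIV] Prop. 1.2 (i), boundary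
`e = p − 1` by (W1). [cite: NeukirchANT1999, Ch. II Prop. (5.5)–(5.7)] -/
theorem logUnits_eq_closedBall_of_le_pred (hp2 : p ≠ 2) (he : absRamificationIdx p K ≤ p - 1) :
    logUnits K = closedBall (0 : K) ‖(ϖ : K)‖ := by
  have hp2' : 2 < p := by have := hp.out.two_le; omega
  rcases he.lt_or_eq with hlt | heq
  · exact logUnits_eq_closedBall_of_le_sub_two p hϖ hp2' (by omega)
  · exact logUnits_eq_closedBall_of_forall_pow_prime_eq_one p hϖ heq hp2 hμ

/-- **No `ζ_p ≠ 1` (`p` odd): `log_p(𝒪_K^×)` is a ball `{‖z‖ ≤ ‖ϖ‖^j}` iff `e ≤ p − 1`** (and then `j = 1`); for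
`e ≥ p` it is not even contained in `𝔪_K` (`DeepRamification`). [cite: NeukirchANT1999, Ch. II Prop. (5.5)–(5.7)] -/
theorem exists_logUnits_eq_closedBall_zpow_iff (hp2 : p ≠ 2) :
    (∃ j : ℤ, logUnits K = closedBall (0 : K) (‖(ϖ : K)‖ ^ j)) ↔ absRamificationIdx p K ≤ p - 1 := by
  have hp3 : 3 ≤ p := by have := hp.out.two_le; omega
  constructor
  · rintro ⟨j, hj⟩
    by_contra hlt
    have hpe : p ≤ absRamificationIdx p K := by omega
    refine DeepRamification.closedBall_ne_zpow_smul_logUnits_of_prime_le p hϖ hp3 hpe j 0 ?_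
    rw [zpow_zero, one_smul, hj]
  · intro he
    exact ⟨1, by rw [zpow_one]; exact logUnits_eq_closedBall_of_le_pred p hϖ hμ hp2 he⟩

/-- **No `ζ_p ≠ 1` (`p` odd): some ball `{‖z‖ ≤ ‖ϖ‖^j}` equals some `p^k·log_p(𝒪_K^×)` iff `e ≤ p − 1`** — the input
shape of the Dupuy–Hilado (Ind2) ball-mover criterion: at torsion-free places over odd `p`, (Ind2) fixes SOME ball
iff `e(v|p) ≤ p − 1`. [cite: NeukirchANT1999, Ch. II Prop. (5.5)–(5.7)] [cite: WeilBNT1967, Ch. II §2, Th. 1–2] -/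
theorem exists_closedBall_eq_zpow_smul_logUnits_iff (hp2 : p ≠ 2) :
    (∃ j k : ℤ, closedBall (0 : K) (‖(ϖ : K)‖ ^ j) = ((p : ℚ_[p]) ^ k) • logUnits K) ↔
      absRamificationIdx p K ≤ p - 1 := by
  have hp3 : 3 ≤ p := by have := hp.out.two_le; omega
  constructor
  · rintro ⟨j, k, hjk⟩
    by_contra hlt
    exact DeepRamification.closedBall_ne_zpow_smul_logUnits_of_prime_le p hϖ hp3 (by omega) j k hjk
  · intro he
    refine ⟨1, 0, ?_⟩
    rw [zpow_zero, one_smul, zpow_one, logUnits_eq_closedBall_of_le_pred p hϖ hμ hp2 he]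

end TorsionFree

end Literature.IUT.LogVolume

end
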